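import Mathlib
import Summits.AtomisticToContinuum.HydrodynamicLimit.Theorems.ImplosionDichotomyDenseExcursionPackingAnalyticSonicApriori
import Summits.AtomisticToContinuum.HydrodynamicLimit.Theorems.ImplosionDichotomyDenseExcursionPackingAnalyticSonicEulerVariable
import Summits.AtomisticToContinuum.HydrodynamicLimit.Theorems.ImplosionDichotomyDenseExcursionPackingAnalyticSonicDampedTransport

/-!
# Uniqueness of the real window solution of the order-`k` packing problem through the sonic point
# (crux `DenseExcursion`, stmt-AtomisticToContinuum-12586, line `sonic-cavity-renewal` v9, stub `stub_analyticPackingImplosion`)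

Helper file (`--supports stmt-AtomisticToContinuum-12586`, line lead a2, wave-5 worker D2, task `sonicWindow_analytic_bound`,
worker report `work/stubs/D2_triangle.REPORT.md`). The real characteristic system
`c₊ P′ = (Λ − b₊₊)P − b₊₋M`, `c₋ M′ = (Λ − b₋₋)M − b₋₊P` (homogeneous) on the real window `(−3ρ, ρ)` is SINGULAR at the sonic
point `x = 0` (`c₊ = x·d(x)`, `d(0) = −κ`), yet for `Λ ≥ Λ₀` a differentiable solution with `M(0) = 0` vanishes identically
(`sonicWindow_real_unique`, REGISTERED helper): this identifies the given real order-`k` coefficient with the real trace of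
the holomorphic solution on the sonic triangle. Proof: on `[0, ρ′]` the Euler a-priori bound (`eulerVariable_apriori_bound`,
exponent `a ≥ Λ/(4κ)`) gives `sup|P| ≤ 8C_β sup|M|/Λ` and the damped transport from `M(0) = 0`
(`dampedTransport_apriori_bound`) gives `sup|M| ≤ 6C_β sup|P|/Λ`; on `[−b, 0]`, `b = min(ρ, 1/Λ)`, the anti-damped transport
costs only `e²` by Grönwall (`norm_le_gronwallBound_of_norm_deriv_right_le`), `sup|M| ≤ 4C_β sup|P|/Λ`; both `2 × 2` systems are
absorbed for `Λ ≥ 10 C_β`; on `(−3ρ, −b]` the system is regular (`c₊ ≥ bκ/2`) and Grönwall with zero data concludes.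

Sources: Coddington–Levinson 1955 Ch. 4; standard. NOT here: the holomorphic side or `Γ`.
-/

noncomputable section

open Set Metric Filter Topology

namespace Summit.AtomisticToContinuum.HydrodynamicLimit.Theorems.PackingAnalyticImplosion

open Summit.AtomisticToContinuum.HydrodynamicLimit.Theorems.R2OneModeTwoConditions
open Summit.AtomisticToContinuum.HydrodynamicLimit.Theorems.SonicCavityRenewal

set_option maxHeartbeats 1600000 in -- one declaration: three regions (Euler/transport absorption twice, regular Grönwall)
/-- **UNIQUENESS OF THE REAL WINDOW SOLUTION THROUGH THE SONIC POINT** (registered helper `sonicWindow_real_unique` of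
`stub_analyticPackingImplosion`): for `Λ ≥ Λ₀`, `0 < ρ ≤ ρ₀`, a differentiable solution `(P, M)` on `(−3ρ, ρ)` of the
homogeneous real characteristic system with `M(0) = 0` vanishes identically. [folklore] -/
theorem sonicWindow_real_unique : ∀ (r : ℝ) (W S : ℝ → ℝ) (Wc Sc : ℂ → ℂ), IsMonatomicProfile r W S → CavityTube r W S → AnalyticOnNhd ℂ Wc (Metric.ball 0 (1 / 10)) → AnalyticOnNhd ℂ Sc (Metric.ball 0 (1 / 10)) → (∀ x : ℝ, |x| < 1 / 10 → Wc (x : ℂ) = ((W x : ℝ) : ℂ) ∧ Sc (x : ℂ) = ((S x : ℝ) : ℂ) ∧ deriv Wc (x : ℂ) = ((deriv W x : ℝ) : ℂ) ∧ deriv Sc (x : ℂ) = ((deriv S x : ℝ) : ℂ)) → ∃ (ρ₀ Λ₀ : ℝ), 0 < ρ₀ ∧ 0 < Λ₀ ∧ ∀ (Λ ρ : ℝ), Λ₀ ≤ Λ → 0 < ρ → ρ ≤ ρ₀ → ∀ (P M : ℝ → ℝ), (∀ x ∈ Set.Ioo (-(3 * ρ)) ρ, DifferentiableAt ℝ P x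 ∧ DifferentiableAt ℝ M x) → (∀ x ∈ Set.Ioo (-(3 * ρ)) ρ, (W x - 1 + S x) * deriv P x = (Λ - (2 / 3 * deriv W x + 2 * W x - r + 2 * deriv S x + 4 * S x)) * P x - (deriv W x / 3 + deriv S x + 2 * S x) * M x ∧ (W x - 1 - S x) * deriv M x = (Λ - (2 / 3 * deriv W x + 2 * W x - r - 2 * deriv S x - 4 * S x)) * M x - (deriv W x / 3 - deriv S x - 2 * S x) * P x) → M 0 = 0 → ∀ x ∈ Set.Ioo (-(3 * ρ)) ρ, P x = 0 ∧ M x = 0 := by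
  intro r W S Wc Sc hprof htube hWc hSc hext
  obtain ⟨R₀, κ, Cb, Ce, d, e, hR₀, hR₀le, hκ, hCb, hCe, hdd, hed, hfac, hd0, hbnd⟩ :=
    sonicTriangle_profile r W S Wc Sc hprof htube hWc hSc hext
  have hr2 : r < 2 := by
    have h3 : (1 : ℝ) < Real.sqrt 3 := by rw [show (1 : ℝ) = Real.sqrt 1 by simp]; exact Real.sqrt_lt_sqrt (by norm_num) (by norm_num)
    linarith [hprof.2.1]
  have hrabs : |r| ≤ 2 := by rw [abs_of_pos (by linarith [hprof.1])]; exact hr2.le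
  have hκ0 : 0 < κ := by linarith
  set Cβ : ℝ := 9 * Cb + 2 with hCβ
  have hCβ2 : 2 ≤ Cβ := by simp only [hCβ]; linarith
  refine ⟨R₀ / 3, 10 * Cβ, by linarith, by linarith, ?_⟩
  intro Λ ρ hΛ hρ hρ₀ P M hdiff heq hM0
  have hΛ0 : 0 < Λ := by linarith
  have hΛC : Cβ ≤ Λ / 2 := by linarith
  set bpp : ℝ → ℝ := fun x => 2 / 3 * deriv W x + 2 * W x - r + 2 * deriv S x + 4 * S x with hbpp
  set bpm : ℝ → ℝ := fun x => deriv W x / 3 + deriv S x + 2 * S x with hbpm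
  set bmm : ℝ → ℝ := fun x => 2 / 3 * deriv W x + 2 * W x - r - 2 * deriv S x - 4 * S x with hbmm
  set bmp : ℝ → ℝ := fun x => deriv W x / 3 - deriv S x - 2 * S x with hbmp
  set dr : ℝ → ℝ := fun x => (d (x : ℂ)).re with hdr
  set cr : ℝ → ℝ := fun x => W x - 1 - S x with hcr
  -- the real coefficient facts on the window
  have hwin : ∀ x ∈ Ioo (-(3 * ρ)) ρ, |x| < R₀ := fun x hx => by rw [abs_lt]; constructor <;> linarith [hx.1, hx.2]
  have hcoefR : ∀ x ∈ Ioo (-(3 * ρ)) ρ, W x - 1 + S x = x * dr x ∧ dr x ≤ -(κ / 2) ∧ |dr x| ≤ 2 * κ ∧ cr x ≤ -1 ∧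
      |cr x| ≤ 3 ∧ |bpp x| ≤ Cβ ∧ |bpm x| ≤ Cβ ∧ |bmm x| ≤ Cβ ∧ |bmp x| ≤ Cβ := by
    intro x hx
    have hxR := hwin x hx
    have hxb : (x : ℂ) ∈ ball (0 : ℂ) R₀ := by
      rw [mem_ball, dist_zero_right, Complex.norm_real, Real.norm_eq_abs]; exact hxR
    have hxb' : (x : ℂ) ∈ ball (0 : ℂ) (1 / 10) := ball_subset_ball hR₀le hxb
    obtain ⟨eW, eS, eW', eS'⟩ := hext x (hxR.trans_le hR₀le)
    obtain ⟨h1, h2, -, h4, -, h6, h7, h8, h9, h10⟩ := hbnd _ hxb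
    obtain ⟨b1, b2, b3, b4⟩ := norm_charCoeff_le hCb h7 h8 h9 h10 hrabs
    rw [eW', eW, eS', eS] at b1; rw [eW', eS', eS] at b2; rw [eW', eW, eS', eS] at b3; rw [eW', eS', eS] at b4
    rw [eW, eS] at h4 h6
    have hf := (hfac _ hxb').1
    rw [eW, eS] at hf
    have hf' := congrArg Complex.re hf
    simp only [Complex.add_re, Complex.sub_re, Complex.ofReal_re, Complex.one_re, Complex.mul_re, Complex.ofReal_im,
      zero_mul, sub_zero] at hf'
    have hdn : |dr x| ≤ 2 * κ := (Complex.abs_re_le_norm _).trans h2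
    have hc4 : cr x ≤ -1 := by
      have : (((W x : ℝ) : ℂ) - 1 - ((S x : ℝ) : ℂ)).re = cr x := by simp [hcr]
      linarith [this ▸ h4]
    have hc6 : |cr x| ≤ 3 := by
      have : ‖((W x : ℝ) : ℂ) - 1 - ((S x : ℝ) : ℂ)‖ = |cr x| := by
        rw [show ((W x : ℝ) : ℂ) - 1 - ((S x : ℝ) : ℂ) = ((cr x : ℝ) : ℂ) by simp only [hcr]; push_cast; ring,
          Complex.norm_real, Real.norm_eq_abs]
      linarith [this ▸ h6]
    have e1 : ‖(2 / 3 * ((deriv W x : ℝ) : ℂ) + 2 * ((W x : ℝ) : ℂ) - (r : ℂ) + 2 * ((deriv S x : ℝ) : ℂ) +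
        4 * ((S x : ℝ) : ℂ))‖ = |bpp x| := by
      rw [show (2 / 3 * ((deriv W x : ℝ) : ℂ) + 2 * ((W x : ℝ) : ℂ) - (r : ℂ) + 2 * ((deriv S x : ℝ) : ℂ) +
        4 * ((S x : ℝ) : ℂ)) = ((bpp x : ℝ) : ℂ) by simp only [hbpp]; push_cast; ring, Complex.norm_real, Real.norm_eq_abs]
    have e2 : ‖((deriv W x : ℝ) : ℂ) / 3 + ((deriv S x : ℝ) : ℂ) + 2 * ((S x : ℝ) : ℂ)‖ = |bpm x| := by
      rw [show ((deriv W x : ℝ) : ℂ) / 3 + ((deriv S x : ℝ) : ℂ) + 2 * ((S x : ℝ) : ℂ) = ((bpm x : ℝ) : ℂ) by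
        simp only [hbpm]; push_cast; ring, Complex.norm_real, Real.norm_eq_abs]
    have e3 : ‖(2 / 3 * ((deriv W x : ℝ) : ℂ) + 2 * ((W x : ℝ) : ℂ) - (r : ℂ) - 2 * ((deriv S x : ℝ) : ℂ) -
        4 * ((S x : ℝ) : ℂ))‖ = |bmm x| := by
      rw [show (2 / 3 * ((deriv W x : ℝ) : ℂ) + 2 * ((W x : ℝ) : ℂ) - (r : ℂ) - 2 * ((deriv S x : ℝ) : ℂ) -
        4 * ((S x : ℝ) : ℂ)) = ((bmm x : ℝ) : ℂ) by simp only [hbmm]; push_cast; ring, Complex.norm_real, Real.norm_eq_abs]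
    have e4 : ‖((deriv W x : ℝ) : ℂ) / 3 - ((deriv S x : ℝ) : ℂ) - 2 * ((S x : ℝ) : ℂ)‖ = |bmp x| := by
      rw [show ((deriv W x : ℝ) : ℂ) / 3 - ((deriv S x : ℝ) : ℂ) - 2 * ((S x : ℝ) : ℂ) = ((bmp x : ℝ) : ℂ) by
        simp only [hbmp]; push_cast; ring, Complex.norm_real, Real.norm_eq_abs]
    exact ⟨by rw [hf'], h1, hdn, hc4, hc6, e1 ▸ b1, e2 ▸ b2, e3 ▸ b3, e4 ▸ b4⟩
  -- derivatives in solved form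
  have hPd : ∀ x ∈ Ioo (-(3 * ρ)) ρ, HasDerivAt P (deriv P x) x := fun x hx => (hdiff x hx).1.hasDerivAt
  have hMd : ∀ x ∈ Ioo (-(3 * ρ)) ρ, HasDerivAt M (deriv M x) x := fun x hx => (hdiff x hx).2.hasDerivAt
  have hcr_ne : ∀ x ∈ Ioo (-(3 * ρ)) ρ, cr x ≠ 0 := fun x hx h => by
    have := (hcoefR x hx).2.2.2.1; rw [h] at this; norm_num at this
  have hMeq : ∀ x ∈ Ioo (-(3 * ρ)) ρ, deriv M x = -((Λ - bmm x) / (-cr x)) * M x + (-(bmp x * P x) / cr x) := by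
    intro x hx
    have h := (heq x hx).2
    have hc := hcr_ne x hx
    field_simp
    simp only [hcr] at h hc ⊢
    field_simp
    linear_combination h
  -- the two EULER bounds (right and left of the sonic point)
  have hEuler : ∀ (b : ℝ) (s : Set ℝ), (s = Icc 0 b ∨ s = Icc (-b) 0) → 0 ≤ b → s ⊆ Ioo (-(3 * ρ)) ρ →
      ∀ Bm : ℝ, (∀ x ∈ s, |M x| ≤ Bm) → ∀ x ∈ s, |P x| ≤ 8 * Cβ * Bm / Λ := by
    intro b s hs hb hsub Bm hBm
    set a : ℝ → ℝ := fun x => (Λ - bpp x) / (-dr x) with ha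
    set G : ℝ → ℝ := fun x => -(bpm x * M x) / dr x with hG
    have hBm0 : ∀ x ∈ s, 0 ≤ Bm := fun x hx => (abs_nonneg _).trans (hBm x hx)
    have ha₀ : ∀ x ∈ s, Λ / (4 * κ) ≤ a x := by
      intro x hx
      obtain ⟨-, hd1, hd2, -, -, hb1, -⟩ := hcoefR x (hsub hx)
      have hdpos : 0 < -dr x := by linarith
      simp only [ha]
      rw [div_le_div_iff₀ (by positivity) hdpos]
      have := (abs_le.1 hb1).2
      have := (abs_le.1 hd2).1
      nlinarith
    have hGb : ∀ x ∈ s, |G x| ≤ 2 * Cβ * Bm / κ := by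
      intro x hx
      obtain ⟨-, hd1, -, -, -, -, hb2, -⟩ := hcoefR x (hsub hx)
      have hdabs : κ / 2 ≤ |dr x| := by rw [abs_of_nonpos (by linarith)]; linarith
      simp only [hG]
      rw [abs_div, abs_neg, abs_mul]
      calc |bpm x| * |M x| / |dr x| ≤ Cβ * Bm / (κ / 2) :=
            div_le_div₀ (mul_nonneg (by linarith) (hBm0 x hx)) (mul_le_mul hb2 (hBm x hx) (abs_nonneg _) (by linarith))
              (by positivity) hdabs
        _ = 2 * Cβ * Bm / κ := by field_simp
    have hPeq : ∀ x ∈ s, x * deriv P x + a x * P x = G x := by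
      intro x hx
      obtain ⟨hc, hd1, -⟩ := hcoefR x (hsub hx)
      have h := (heq x (hsub hx)).1
      rw [hc] at h
      have hdne : dr x ≠ 0 := by intro h0; rw [h0] at hd1; linarith
      simp only [ha, hG]
      field_simp
      linear_combination h
    have hPdiff : ∀ x ∈ s, DifferentiableAt ℝ P x := fun x hx => (hdiff x (hsub hx)).1
    have hres : ∀ x ∈ s, |P x| ≤ (2 * Cβ * Bm / κ) / (Λ / (4 * κ)) := by
      rcases hs with hs | hs
      · subst hs
        exact eulerVariable_apriori_bound a G P b (Λ / (4 * κ)) (2 * Cβ * Bm / κ) hb (by positivity) ha₀ hGb hPdiff hPeq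
      · subst hs
        exact eulerVariable_apriori_bound_neg hb (by positivity) ha₀ hGb hPdiff hPeq
    intro x hx
    calc |P x| ≤ (2 * Cβ * Bm / κ) / (Λ / (4 * κ)) := hres x hx
      _ = 8 * Cβ * Bm / Λ := by field_simp; ring
  -- TRANSPORT to the right of the sonic point
  have hTransR : ∀ b : ℝ, 0 ≤ b → Icc 0 b ⊆ Ioo (-(3 * ρ)) ρ → ∀ Bp : ℝ, (∀ x ∈ Icc 0 b, |P x| ≤ Bp) →
      ∀ x ∈ Icc 0 b, |M x| ≤ 6 * Cβ * Bp / Λ := by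
    intro b hb hsub Bp hBp
    set β : ℝ → ℝ := fun x => (Λ - bmm x) / (-cr x) with hβ
    set F : ℝ → ℝ := fun x => -(bmp x * P x) / cr x with hF
    have hBp0 : 0 ≤ Bp := (abs_nonneg _).trans (hBp 0 ⟨le_rfl, hb⟩)
    have hβ₀ : ∀ x ∈ Icc 0 b, Λ / 6 ≤ β x := by
      intro x hx
      obtain ⟨-, -, -, hc1, hc2, -, -, hb3, -⟩ := hcoefR x (hsub hx)
      simp only [hβ]
      rw [div_le_div_iff₀ (by norm_num) (by linarith)]
      have := (abs_le.1 hb3).2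
      have := (abs_le.1 hc2).1
      nlinarith
    have hFb : ∀ x ∈ Icc 0 b, |F x| ≤ Cβ * Bp := by
      intro x hx
      obtain ⟨-, -, -, hc1, -, -, -, -, hb4⟩ := hcoefR x (hsub hx)
      simp only [hF]
      rw [abs_div, abs_neg, abs_mul]
      calc |bmp x| * |P x| / |cr x| ≤ |bmp x| * |P x| / 1 :=
            div_le_div_of_nonneg_left (by positivity) one_pos (by rw [abs_of_nonpos (by linarith)]; linarith)
        _ ≤ Cβ * Bp := by rw [div_one]; exact mul_le_mul hb4 (hBp x hx) (abs_nonneg _) (by linarith)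
    have hder : ∀ x ∈ Icc 0 b, HasDerivAt M (-β x * M x + F x) x := fun x hx =>
      (hMd x (hsub hx)).congr_deriv (hMeq x (hsub hx))
    intro x hx
    have key := dampedTransport_apriori_bound β F M 0 b (Λ / 6) (Cβ * Bp) hb (by positivity) hβ₀ hFb hder x hx
    rw [hM0, abs_zero, zero_mul, zero_add] at key
    calc |M x| ≤ Cβ * Bp / (Λ / 6) := key
      _ = 6 * Cβ * Bp / Λ := by field_simp
  -- TRANSPORT to the left (anti-damped, short interval `b Λ ≤ 1`)
  have hTransL : ∀ b : ℝ, 0 ≤ b → b * Λ ≤ 1 → Icc (-b) 0 ⊆ Ioo (-(3 * ρ)) ρ → ∀ Bp : ℝ, (∀ x ∈ Icc (-b) 0, |P x| ≤ Bp) →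
      ∀ x ∈ Icc (-b) 0, |M x| ≤ 4 * Cβ * Bp / Λ := by
    intro b hb hbΛ hsub Bp hBp
    have hBp0 : 0 ≤ Bp := (abs_nonneg _).trans (hBp 0 ⟨by linarith, le_rfl⟩)
    set Mt : ℝ → ℝ := fun y => M (-y) with hMt
    have hmem : ∀ y ∈ Icc 0 b, -y ∈ Icc (-b) 0 := fun y hy => ⟨by linarith [hy.2], by linarith [hy.1]⟩
    have hMtd : ∀ y ∈ Icc 0 b, HasDerivAt Mt (-deriv M (-y)) y := fun y hy => by
      have h := (hMd (-y) (hsub (hmem y hy))).comp y (hasDerivAt_neg y)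
      simp only [hMt]
      exact h.congr_deriv (by ring)
    have hcont : ContinuousOn Mt (Icc 0 b) := fun y hy => (hMtd y hy).continuousAt.continuousWithinAt
    have hbound : ∀ y ∈ Ico 0 b, ‖-deriv M (-y)‖ ≤ 2 * Λ * ‖Mt y‖ + Cβ * Bp := by
      intro y hy
      have hy' : -y ∈ Icc (-b) 0 := hmem y ⟨hy.1, hy.2.le⟩
      obtain ⟨-, -, -, hc1, hc2, -, -, hb3, hb4⟩ := hcoefR _ (hsub hy')
      rw [hMeq _ (hsub hy'), Real.norm_eq_abs, Real.norm_eq_abs, abs_neg]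
      simp only [hMt]
      have hcpos : 0 < -cr (-y) := by linarith
      have hβle : |(Λ - bmm (-y)) / -cr (-y)| ≤ 2 * Λ := by
        rw [abs_div, abs_of_pos hcpos, div_le_iff₀ hcpos]
        have := (abs_le.1 hb3).1; have := (abs_le.1 hb3).2
        rw [abs_le]; constructor <;> nlinarith
      have hF : |-(bmp (-y) * P (-y)) / cr (-y)| ≤ Cβ * Bp := by
        rw [abs_div, abs_neg, abs_mul]
        calc |bmp (-y)| * |P (-y)| / |cr (-y)| ≤ |bmp (-y)| * |P (-y)| / 1 :=
              div_le_div_of_nonneg_left (by positivity) one_pos (by rw [abs_of_nonpos (by linarith)]; linarith)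
          _ ≤ Cβ * Bp := by rw [div_one]; exact mul_le_mul hb4 (hBp _ hy') (abs_nonneg _) (by linarith)
      calc |-((Λ - bmm (-y)) / -cr (-y)) * M (-y) + -(bmp (-y) * P (-y)) / cr (-y)|
          ≤ |-((Λ - bmm (-y)) / -cr (-y)) * M (-y)| + |-(bmp (-y) * P (-y)) / cr (-y)| := abs_add_le _ _
        _ ≤ 2 * Λ * |M (-y)| + Cβ * Bp := by
            rw [abs_mul, abs_neg]
            exact add_le_add (mul_le_mul_of_nonneg_right hβle (abs_nonneg _)) hF
    have hgr := norm_le_gronwallBound_of_norm_deriv_right_le (f := Mt) (f' := fun y => -deriv M (-y)) (δ := 0)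
      (K := 2 * Λ) (ε := Cβ * Bp) (a := 0) (b := b) hcont
      (fun y hy => (hMtd y ⟨hy.1, hy.2.le⟩).hasDerivWithinAt) (by simp [hMt, hM0]) hbound
    intro x hx
    have hy : -x ∈ Icc 0 b := ⟨by linarith [hx.2], by linarith [hx.1]⟩
    have h := hgr (-x) hy
    simp only [hMt, neg_neg, sub_zero, Real.norm_eq_abs] at h
    rw [gronwallBound_of_K_ne_0 (by positivity)] at h
    simp only [zero_mul, zero_add] at h
    have hexp : Real.exp (2 * Λ * -x) ≤ 8 := by
      have h1 : 2 * Λ * -x ≤ 2 := by nlinarith [hx.1]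
      calc Real.exp (2 * Λ * -x) ≤ Real.exp 2 := Real.exp_le_exp.2 h1
        _ = Real.exp 1 ^ 2 := by rw [← Real.exp_nat_mul]; norm_num
        _ ≤ 8 := by nlinarith [Real.exp_one_lt_d9, Real.exp_pos 1]
    calc |M x| ≤ Cβ * Bp / (2 * Λ) * (Real.exp (2 * Λ * -x) - 1) := h
      _ ≤ Cβ * Bp / (2 * Λ) * 7 := by gcongr; linarith
      _ ≤ 4 * Cβ * Bp / Λ := by
          rw [div_mul_eq_mul_div, div_le_div_iff₀ (by positivity) hΛ0]
          have : 0 ≤ Cβ * Bp * Λ := by positivity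
          nlinarith
  -- ABSORPTION: vanishing on `[0, b]` and on `[-b', 0]`
  have hcontM : ∀ s ⊆ Ioo (-(3 * ρ)) ρ, ContinuousOn (fun x => |M x|) s := fun s hs x hx =>
    (continuous_abs.continuousAt.comp (hdiff x (hs hx)).2.continuousAt).continuousWithinAt
  have hzeroR : ∀ b : ℝ, 0 ≤ b → b < ρ → ∀ x ∈ Icc 0 b, P x = 0 ∧ M x = 0 := by
    intro b hb hbρ
    have hsub : Icc 0 b ⊆ Ioo (-(3 * ρ)) ρ := fun x hx => ⟨by linarith [hx.1], by linarith [hx.2]⟩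
    obtain ⟨x₀, hx₀, hmax⟩ := (isCompact_Icc (a := (0:ℝ)) (b := b)).exists_isMaxOn ⟨0, left_mem_Icc.2 hb⟩ (hcontM _ hsub)
    have hBm : ∀ x ∈ Icc 0 b, |M x| ≤ |M x₀| := fun x hx => hmax hx
    have hP := hEuler b (Icc 0 b) (Or.inl rfl) hb hsub _ hBm
    have hM := hTransR b hb hsub _ hP x₀ hx₀
    have hsmall : 6 * Cβ * (8 * Cβ * |M x₀| / Λ) / Λ ≤ |M x₀| / 2 := by
      rw [show 6 * Cβ * (8 * Cβ * |M x₀| / Λ) / Λ = 48 * (Cβ / Λ) ^ 2 * |M x₀| by field_simp; ring]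
      have hq : Cβ / Λ ≤ 1 / 10 := by rw [div_le_div_iff₀ hΛ0 (by norm_num)]; linarith
      have hq0 : 0 ≤ Cβ / Λ := by positivity
      nlinarith [abs_nonneg (M x₀), mul_le_mul hq hq hq0 (by norm_num)]
    have hM0' : |M x₀| = 0 := le_antisymm (by linarith [abs_nonneg (M x₀)]) (abs_nonneg _)
    intro x hx
    have h1 : |M x| ≤ 0 := (hBm x hx).trans hM0'.le
    have h2 : |P x| ≤ 0 := (hP x hx).trans (by rw [hM0']; simp)
    exact ⟨abs_nonpos_iff.1 h2, abs_nonpos_iff.1 h1⟩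
  set b₁ : ℝ := min ρ (1 / Λ) with hb₁
  have hb₁pos : 0 < b₁ := lt_min hρ (by positivity)
  have hb₁Λ : b₁ * Λ ≤ 1 := by
    calc b₁ * Λ ≤ 1 / Λ * Λ := mul_le_mul_of_nonneg_right (min_le_right _ _) hΛ0.le
      _ = 1 := by field_simp
  have hsubL : Icc (-b₁) 0 ⊆ Ioo (-(3 * ρ)) ρ := fun x hx => ⟨by linarith [hx.1, min_le_left ρ (1 / Λ)], by linarith [hx.2]⟩
  have hzeroL : ∀ x ∈ Icc (-b₁) 0, P x = 0 ∧ M x = 0 := by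
    obtain ⟨x₀, hx₀, hmax⟩ := (isCompact_Icc (a := -b₁) (b := (0:ℝ))).exists_isMaxOn ⟨0, right_mem_Icc.2 (by linarith)⟩
      (hcontM _ hsubL)
    have hBm : ∀ x ∈ Icc (-b₁) 0, |M x| ≤ |M x₀| := fun x hx => hmax hx
    have hP := hEuler b₁ (Icc (-b₁) 0) (Or.inr rfl) hb₁pos.le hsubL _ hBm
    have hM := hTransL b₁ hb₁pos.le hb₁Λ hsubL _ hP x₀ hx₀
    have hsmall : 4 * Cβ * (8 * Cβ * |M x₀| / Λ) / Λ ≤ |M x₀| / 2 := by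
      rw [show 4 * Cβ * (8 * Cβ * |M x₀| / Λ) / Λ = 32 * (Cβ / Λ) ^ 2 * |M x₀| by field_simp; ring]
      have hq : Cβ / Λ ≤ 1 / 10 := by rw [div_le_div_iff₀ hΛ0 (by norm_num)]; linarith
      have hq0 : 0 ≤ Cβ / Λ := by positivity
      nlinarith [abs_nonneg (M x₀), mul_le_mul hq hq hq0 (by norm_num)]
    have hM0' : |M x₀| = 0 := le_antisymm (by linarith [abs_nonneg (M x₀)]) (abs_nonneg _)
    intro x hx
    have h1 : |M x| ≤ 0 := (hBm x hx).trans hM0'.le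
    have h2 : |P x| ≤ 0 := (hP x hx).trans (by rw [hM0']; simp)
    exact ⟨abs_nonpos_iff.1 h2, abs_nonpos_iff.1 h1⟩
  -- the REGULAR region `(-3ρ, -b₁]`: Grönwall with zero data
  have hzeroF : ∀ x₁ : ℝ, -(3 * ρ) < x₁ → x₁ ≤ -b₁ → P x₁ = 0 ∧ M x₁ = 0 := by
    intro x₁ hx₁ hx₁b
    set φ : ℝ → ℝ := fun y => P (-y) * P (-y) + M (-y) * M (-y) with hφ
    have hmem : ∀ y ∈ Icc b₁ (-x₁), -y ∈ Ioo (-(3 * ρ)) ρ := fun y hy =>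
      ⟨by linarith [hy.2], by linarith [hy.1, min_le_left ρ (1 / Λ)]⟩
    set KA : ℝ := (Λ + Cβ) * (2 / (b₁ * κ) + 1) with hKA
    have hKA0 : 0 ≤ KA := by positivity
    have hφd : ∀ y ∈ Icc b₁ (-x₁), HasDerivAt φ (-(2 * P (-y) * deriv P (-y) + 2 * M (-y) * deriv M (-y))) y := by
      intro y hy
      have hP := (hPd (-y) (hmem y hy)).comp y (hasDerivAt_neg y)
      have hM := (hMd (-y) (hmem y hy)).comp y (hasDerivAt_neg y)
      have h := (hP.mul hP).add (hM.mul hM)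
      simp only [hφ]
      refine h.congr_deriv ?_
      simp only [Function.comp]
      ring
    have hcont : ContinuousOn φ (Icc b₁ (-x₁)) := fun y hy => (hφd y hy).continuousAt.continuousWithinAt
    have hbound : ∀ y ∈ Ico b₁ (-x₁), ‖-(2 * P (-y) * deriv P (-y) + 2 * M (-y) * deriv M (-y))‖ ≤ 4 * KA * ‖φ y‖ + 0 := by
      intro y hy
      have hy' : y ∈ Icc b₁ (-x₁) := ⟨hy.1, hy.2.le⟩
      have hmy := hmem y hy'
      obtain ⟨hc, hd1, hd2, hc1, hc2, hb1, hb2, hb3, hb4⟩ := hcoefR _ hmy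
      obtain ⟨e1, e2⟩ := heq _ hmy
      rw [hc] at e1
      have hcp : b₁ * κ / 2 ≤ -y * dr (-y) := by nlinarith [hy.1, hb₁pos]
      have hcp0 : 0 < -y * dr (-y) := lt_of_lt_of_le (by positivity) hcp
      -- solved derivatives and their bounds
      have hP' : |deriv P (-y)| ≤ (Λ + Cβ) * (2 / (b₁ * κ)) * (|P (-y)| + |M (-y)|) := by
        have : deriv P (-y) = ((Λ - bpp (-y)) * P (-y) - bpm (-y) * M (-y)) / (-y * dr (-y)) := by
          rw [eq_div_iff hcp0.ne']; linear_combination e1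
        rw [this, abs_div, abs_of_pos hcp0, div_le_iff₀ hcp0]
        have h1 : |(Λ - bpp (-y)) * P (-y) - bpm (-y) * M (-y)| ≤ (Λ + Cβ) * (|P (-y)| + |M (-y)|) := by
          calc |(Λ - bpp (-y)) * P (-y) - bpm (-y) * M (-y)| ≤ |(Λ - bpp (-y)) * P (-y)| + |bpm (-y) * M (-y)| :=
                abs_sub _ _
            _ ≤ (Λ + Cβ) * |P (-y)| + (Λ + Cβ) * |M (-y)| := by
                rw [abs_mul, abs_mul]
                refine add_le_add (mul_le_mul_of_nonneg_right ?_ (abs_nonneg _))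
                  (mul_le_mul_of_nonneg_right (by linarith) (abs_nonneg _))
                exact (abs_sub _ _).trans (by rw [abs_of_pos hΛ0]; linarith)
            _ = (Λ + Cβ) * (|P (-y)| + |M (-y)|) := by ring
        calc |(Λ - bpp (-y)) * P (-y) - bpm (-y) * M (-y)| ≤ (Λ + Cβ) * (|P (-y)| + |M (-y)|) := h1
          _ = (Λ + Cβ) * (2 / (b₁ * κ)) * (|P (-y)| + |M (-y)|) * (b₁ * κ / 2) := by field_simp
          _ ≤ (Λ + Cβ) * (2 / (b₁ * κ)) * (|P (-y)| + |M (-y)|) * (-y * dr (-y)) := by gcongr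
      have hM' : |deriv M (-y)| ≤ (Λ + Cβ) * 1 * (|P (-y)| + |M (-y)|) := by
        have hcne : cr (-y) ≠ 0 := hcr_ne _ hmy
        have : deriv M (-y) = ((Λ - bmm (-y)) * M (-y) - bmp (-y) * P (-y)) / cr (-y) := by
          rw [eq_div_iff hcne]; simp only [hcr]; linear_combination e2
        rw [this, abs_div]
        have hc3 : 1 ≤ |cr (-y)| := by rw [abs_of_nonpos (by linarith)]; linarith
        calc |(Λ - bmm (-y)) * M (-y) - bmp (-y) * P (-y)| / |cr (-y)|
            ≤ |(Λ - bmm (-y)) * M (-y) - bmp (-y) * P (-y)| / 1 := div_le_div_of_nonneg_left (abs_nonneg _) one_pos hc3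
          _ ≤ (Λ + Cβ) * 1 * (|P (-y)| + |M (-y)|) := by
              rw [div_one]
              calc |(Λ - bmm (-y)) * M (-y) - bmp (-y) * P (-y)| ≤ |(Λ - bmm (-y)) * M (-y)| + |bmp (-y) * P (-y)| :=
                    abs_sub _ _
                _ ≤ (Λ + Cβ) * |M (-y)| + (Λ + Cβ) * |P (-y)| := by
                    rw [abs_mul, abs_mul]
                    refine add_le_add (mul_le_mul_of_nonneg_right ?_ (abs_nonneg _))
                      (mul_le_mul_of_nonneg_right (by linarith) (abs_nonneg _))
                    exact (abs_sub _ _).trans (by rw [abs_of_pos hΛ0]; linarith)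
                _ = (Λ + Cβ) * 1 * (|P (-y)| + |M (-y)|) := by ring
      have hsum : |deriv P (-y)| + |deriv M (-y)| ≤ KA * (|P (-y)| + |M (-y)|) := by
        simp only [hKA]; nlinarith [hP', hM', abs_nonneg (P (-y)), abs_nonneg (M (-y))]
      rw [Real.norm_eq_abs, Real.norm_eq_abs, add_zero, abs_neg]
      have hφabs : |φ y| = P (-y) * P (-y) + M (-y) * M (-y) := by
        simp only [hφ]; exact abs_of_nonneg (by nlinarith)
      rw [hφabs]
      calc |2 * P (-y) * deriv P (-y) + 2 * M (-y) * deriv M (-y)|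
          ≤ |2 * P (-y) * deriv P (-y)| + |2 * M (-y) * deriv M (-y)| := abs_add_le _ _
        _ = 2 * (|P (-y)| * |deriv P (-y)|) + 2 * (|M (-y)| * |deriv M (-y)|) := by
            simp only [abs_mul]; norm_num; ring
        _ ≤ 2 * (|P (-y)| + |M (-y)|) * (|deriv P (-y)| + |deriv M (-y)|) := by
            nlinarith [abs_nonneg (P (-y)), abs_nonneg (M (-y)), abs_nonneg (deriv P (-y)), abs_nonneg (deriv M (-y))]
        _ ≤ 2 * (|P (-y)| + |M (-y)|) * (KA * (|P (-y)| + |M (-y)|)) := by gcongr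
        _ ≤ 4 * KA * (P (-y) * P (-y) + M (-y) * M (-y)) := by
            nlinarith [sq_abs (P (-y)), sq_abs (M (-y)), sq_nonneg (|P (-y)| - |M (-y)|)]
    have h0 : ‖φ b₁‖ ≤ 0 := by
      obtain ⟨hP0, hM00⟩ := hzeroL (-b₁) ⟨le_rfl, by linarith⟩
      simp [hφ, hP0, hM00]
    have hgr := norm_le_gronwallBound_of_norm_deriv_right_le hcont (fun y hy => (hφd y ⟨hy.1, hy.2.le⟩).hasDerivWithinAt)
      h0 hbound (-x₁) ⟨by linarith, le_rfl⟩
    rw [gronwallBound_ε0_δ0, Real.norm_eq_abs] at hgr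
    have hφ0 : φ (-x₁) = 0 := abs_nonpos_iff.1 hgr
    simp only [hφ, neg_neg] at hφ0
    constructor <;> nlinarith [sq_nonneg (P x₁), sq_nonneg (M x₁)]
  -- conclusion
  intro x hx
  rcases le_or_gt 0 x with h0x | hx0
  · exact hzeroR ((x + ρ) / 2) (by linarith) (by linarith [hx.2]) x ⟨h0x, by linarith [hx.2]⟩
  · rcases le_or_gt (-b₁) x with h1 | h1
    · exact hzeroL x ⟨h1, hx0.le⟩
    · exact hzeroF x hx.1 h1.le

end Summit.AtomisticToContinuum.HydrodynamicLimit.Theorems.PackingAnalyticImplosion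

end
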